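import Summits.BirchSwinnertonDyer.BirchSwinnertonDyer.Theorems.KolyvaginDepthDoorDepthTableRowKitOfPrint
import Summits.BirchSwinnertonDyer.BirchSwinnertonDyer.Theorems.KolyvaginDepthDoorDepthTableRows1
import Summits.BirchSwinnertonDyer.BirchSwinnertonDyer.Theorems.KolyvaginDepthDoorDepthTableRows2
import Summits.BirchSwinnertonDyer.BirchSwinnertonDyer.Theorems.KolyvaginDepthDoorDepthTableOddPrimeKit
import Summits.BirchSwinnertonDyer.BirchSwinnertonDyer.Theorems.Rank1ResidualIntModelReduction
import Literature.NumberTheory.EllipticCurves.ComplexMultiplicationNotSemistable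
import HarnessLib

/-!
# Route `KolyvaginDepthDoor` — DEPTH-TABLE rows WITHOUT Kolyvagin's structure theorem (2/5):
# `433a1` `(5, -8, 79)`, `446d1` `(5, -23, 19)`, `563a1` `(5, -8, 199)` (crux `KolyvaginDepthSupply`, stmt-BirchSwinnertonDyer-21765)

Helper file (`--supports stmt-BirchSwinnertonDyer-21765 --as helper`); it closes nothing and BSD is
not proved by it. Continuation of `…DepthTableRowsOfPrint1` (rows `389a1`, `709a1`, `718b1`): the
rows of `…DepthTableRows1/2` rewritten over the row kit WITHOUT `hF`
(`depthRow_of_print_of_intModel_certificate`, file `…DepthTableRowKitOfPrint`; engine: Kolyvagin's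
minimal-depth descent, `Literature…HeegnerPointsKolyvaginDepthDescent`, proved as algebra), with the
two extra kernel side conditions discharged per curve: `p ∈ B(E)` (the `p`-adic tower surjectivity,
`hasSurjectiveModNGaloisRep_pow_of_intModel_certificate`: semistability, an irreducibility witness,
and a multiplicative prime `ℓ₀ ∥ Δ`) and `¬ HasCM` (multiplicative reduction at `ℓ₀`).

Each row: for ANY imaginary quadratic `K` with the row's `d_K`, any frame and any COMPATIBLE system of
Kolyvagin–Heegner data, granted the five named leaves `sign_conjAct_kolyvaginClass` (Gross 5.4 (2)),
`lemma43_kolyvaginClass_mem_selmerLocalKer` (McCallum L4.3), `prop44_localOrder_kolyvaginClass_mul_eq`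
(P4.4), `lemma53_selmer_eigen_dependent_at` (L5.3), `prop22_reciprocity_eigen_finset` (P2.2+L5.3):
bit `c_1(ℓ) ≠ 0` + one rational point of infinite order on the twist ⟹ `corank_{ℤ_p} Ш(E)[p^∞] = 0`,
`rank E(ℚ) = 2`, `rank E^{(d_K)}(ℚ) = 1`. Honest trade versus the hF-rows: Kolyvagin Thm. 4 (XL) ↦
five S/M leaves + the SYSTEM of data + one twist point. The three additive curves of the table
(`664a1`, `916c1`, `944e1`) are not treated here (the tower certificate used is the semistable one).
Per-curve; BSD is not proved by it.
-/

set_option linter.dupNamespace false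

noncomputable section

open scoped Classical NumberField

namespace Summit.BirchSwinnertonDyer.BirchSwinnertonDyer.Theorems.KolyvaginDepthDoor

open Literature.NumberTheory.EllipticCurves Literature.NumberTheory.EllipticCurves.ModularForms
  Literature.NumberTheory.EllipticCurves.McCallum1991 WeierstrassCurve
open Summit.BirchSwinnertonDyer.BirchSwinnertonDyer.Rank2Observatory
open Summit.BirchSwinnertonDyer.BirchSwinnertonDyer.Rank1Residual

/-! ## Row `433a1` = `[1,0,0,0,1]` (`N = 433, Δ = −433`): `(p, d_K, ℓ) = (5, -8, 79)` -/

namespace C433a1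

/-- **`5 ∈ B(433a1)`: `ρ̄_{E,5^m}` onto for every `m`** (semistable `gcd(c₄, Δ) = 1`;
`X² − a_3 X + 3`, `a_3 = -2`, root-free mod `5`: `E[5]` irreducible (Mazur 6.3), onto (Serre
Prop. 21); the multiplicative prime `433 ∥ Δ` with `5 ∤ 1` lifts the image to `GL₂(ℤ/5^m)`).
[cite: Serre1972, §5.4 Prop. 21] [cite: SerreAbelianLadic1968, Ch. IV §3.4] -/
theorem hasSurjectiveModNGaloisRep_pow_5 (m : ℕ) :
    ((⟨1, 0, 0, 0, 1⟩ : WeierstrassCurve ℤ).map (Int.castRingHom ℚ)).HasSurjectiveModNGaloisRep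
      (5 ^ m : ℕ) := by
  have hn : ∀ t : ZMod 5, t ^ 2 - (((3 : ℕ) : ℤ) + 1 - (6 : ℕ) : ℤ) * t + ((3 : ℕ) : ZMod 5) ≠ 0 := by
    decide +kernel
  haveI := Fact.mk (by norm_num : Nat.Prime 5)
  haveI := Fact.mk (by norm_num : Nat.Prime 3)
  haveI := isElliptic_c433a1
  haveI := isGloballyMinimal_c433a1
  exact hasSurjectiveModNGaloisRep_pow_of_intModel_certificate intModel
    (by rw [Int.isCoprime_iff_gcd_eq_one]; decide +kernel) 5 3 (by norm_num) (by decide +kernel)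
    (n := 6) card_3 hn 433 (by norm_num) (by norm_num) (by decide +kernel) (by decide +kernel)
    (e := 1) (by decide +kernel) (by decide +kernel) (by decide +kernel) m

/-- **`433a1` is not CM** (multiplicative reduction at `433`; a CM curve has integral `j`).
[cite: SilvermanATAEC1994, Thm. II.6.4 (PDF p. 148)] [cite: CremonaAlgorithms1997, Table 1 (433a1)] -/
theorem not_hasCM :
    haveI := isElliptic_c433a1;
    ¬ ((⟨1, 0, 0, 0, 1⟩ : WeierstrassCurve ℤ).map (Int.castRingHom ℚ)).HasCM := by
  haveI := isElliptic_c433a1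
  haveI := isGloballyMinimal_c433a1
  haveI := Fact.mk (by norm_num : Nat.Prime 433)
  intro hCM
  exact not_hasMultiplicativeReductionAtPrime_of_hasCM _ hCM 433
    (IntModel.hasMultiplicativeReductionAtPrime_of_intModel intModel 433 (by decide +kernel)
      (by decide +kernel))

/-- **DEPTH-TABLE ROW `433a1`, `(p, d_K, ℓ) = (5, -8, 79)`, WITHOUT Kolyvagin's structure theorem**:
for ANY imaginary quadratic `K` with `d_K = -8`, any frame `(Dt, β, ι)` and any COMPATIBLE system `d n`
of Kolyvagin–Heegner data, granted the five named McCallum/Gross leaves (Gross Prop. 5.4 (2);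
McCallum Lemma 4.3, Prop. 4.4, Lemma 5.3, Prop. 2.2): the bit `(d 79).kolyvaginClass _ 1 ≠ 0` and one
rational point of infinite order on `E^{(-8)}` give `corank_{ℤ_5} Ш(E)[5^∞] = 0`,
`rank_ℤ E(ℚ) = 2`, `rank_ℤ E^{(-8)}(ℚ) = 1`, `corank_{ℤ_5} Ш(E^{(-8)})[5^∞] = 0`; every
side condition (`5 ∈ B(E)`, non-CM, Heegner hypothesis, Kolyvagin prime, `2 ≤ rank`) is a kernel
theorem. Twin of `C433a1.depthRow_5_neg8_79` (file `…DepthTableRows1`, modulo `hF`).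
CONDITIONAL on the five facts, the bit, the twist point; per-curve; BSD is not proved by it.
[cite: Kolyvagin1991MathAnn, Thm. 2.3] [cite: McCallumLMS1991, §§2–5]
[cite: JetchevLauterStein2009, §3.6 (arXiv:0707.0032)] -/
theorem depthRow_5_neg8_79_of_print
    (h54 : sign_conjAct_kolyvaginClass) (h43 : lemma43_kolyvaginClass_mem_selmerLocalKer)
    (h44 : prop44_localOrder_kolyvaginClass_mul_eq) (h53 : lemma53_selmer_eigen_dependent_at)
    (h22 : prop22_reciprocity_eigen_finset)
    (K : Type) [Field K] [NumberField K] (hK : IsImaginaryQuadratic K)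
    (hD : NumberField.discr K = -8) :
    haveI := isElliptic_c433a1;
    haveI := isGloballyMinimal_c433a1;
    haveI : NeZero (((⟨1, 0, 0, 0, 1⟩ : WeierstrassCurve ℤ).map (Int.castRingHom ℚ)).conductorNorm ℤ) :=
      neZero_conductorNorm_of_isElliptic _;
    ∀ (Dt : ModularParametrizationData ((⟨1, 0, 0, 0, 1⟩ : WeierstrassCurve ℤ).map (Int.castRingHom ℚ))
        (((⟨1, 0, 0, 0, 1⟩ : WeierstrassCurve ℤ).map (Int.castRingHom ℚ)).conductorNorm ℤ)) (β : ℤ)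
      (ι : K →+* ℂ) (d : ∀ m : ℕ, KolyvaginHeegnerData Dt β ι m),
    (∀ (m l : ℕ), ∀ l' ∈ m.primeFactors, ∀ (x : ringClassField K ι m)
      (x' : ringClassField K ι (m * l)),
      (x : ℂ) = x' → (((d (m * l)).σ l' x' : ringClassField K ι (m * l)) : ℂ) = ((d m).σ l' x : ℂ)) →
    (∀ (m l : ℕ), ∀ s ∈ (d m).S, ∃ s' ∈ (d (m * l)).S, ∀ (x : ringClassField K ι m)
      (x' : ringClassField K ι (m * l)),
      (x : ℂ) = x' → ((s' x' : ringClassField K ι (m * l)) : ℂ) = (s x : ℂ)) →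
    (∀ (m l : ℕ), ∀ s' ∈ (d (m * l)).S, ∃ s ∈ (d m).S, ∀ (x : ringClassField K ι m)
      (x' : ringClassField K ι (m * l)),
      (x : ℂ) = x' → ((s' x' : ringClassField K ι (m * l)) : ℂ) = (s x : ℂ)) →
    (∀ (m l : ℕ) (x : ringClassField K ι m) (x' : ringClassField K ι (m * l)),
      (x : ℂ) = x' → (d (m * l)).emb x' = (d m).emb x) →
    (d 79).kolyvaginClass (p := 5) (by norm_num) 1 ≠ 0 →
    1 ≤ (((⟨1, 0, 0, 0, 1⟩ : WeierstrassCurve ℤ).map (Int.castRingHom ℚ)).quadraticTwist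
      ((-8 : ℤ) : ℚ)).mordellWeilRank →
    ((⟨1, 0, 0, 0, 1⟩ : WeierstrassCurve ℤ).map (Int.castRingHom ℚ)).shaCorank 5 = 0 ∧
      ((⟨1, 0, 0, 0, 1⟩ : WeierstrassCurve ℤ).map (Int.castRingHom ℚ)).mordellWeilRank = 2 ∧
      (((⟨1, 0, 0, 0, 1⟩ : WeierstrassCurve ℤ).map (Int.castRingHom ℚ)).quadraticTwist
        ((-8 : ℤ) : ℚ)).mordellWeilRank = 1 ∧
      (((⟨1, 0, 0, 0, 1⟩ : WeierstrassCurve ℤ).map (Int.castRingHom ℚ)).quadraticTwist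
        ((-8 : ℤ) : ℚ)).shaCorank 5 = 0 := by
  haveI := isElliptic_c433a1
  haveI := isGloballyMinimal_c433a1
  haveI : NeZero (((⟨1, 0, 0, 0, 1⟩ : WeierstrassCurve ℤ).map (Int.castRingHom ℚ)).conductorNorm ℤ) :=
    neZero_conductorNorm_of_isElliptic _
  intro Dt β ι d hσ hS₁ hS₂ hemb hne htw
  haveI := Fact.mk (by norm_num : Nat.Prime 5)
  exact depthRow_of_print_of_intModel_certificate intModel h54 h43 h44 h53 h22 not_hasCM
    KernelCerts001.C433a1.two_le_rank 5 (by norm_num) hasSurjectiveModNGaloisRep_pow_5 K hK hD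
    (by norm_num) (by norm_num) heegner_neg8 79 (by norm_num) (by norm_num) (by decide +kernel)
    (by norm_num) (by norm_num) (by norm_num) (by norm_num) (n := 70) card_79 (by norm_num) Dt β ι
    d hσ hS₁ hS₂ hemb hne htw

end C433a1

/-! ## Row `446d1` = `[1,-1,0,-4,4]` (`N = 446, |Δ| = 2²·223`): `(p, d_K, ℓ) = (5, -23, 19)` -/

namespace C446d1

/-- **`5 ∈ B(446d1)`: `ρ̄_{E,5^m}` onto for every `m`** (semistable `gcd(c₄, Δ) = 1`;
`X² − a_3 X + 3`, `a_3 = -3`, root-free mod `5`: `E[5]` irreducible (Mazur 6.3), onto (Serre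
Prop. 21); the multiplicative prime `223 ∥ Δ` with `5 ∤ 1` lifts the image to `GL₂(ℤ/5^m)`).
[cite: Serre1972, §5.4 Prop. 21] [cite: SerreAbelianLadic1968, Ch. IV §3.4] -/
theorem hasSurjectiveModNGaloisRep_pow_5 (m : ℕ) :
    ((⟨1, -1, 0, -4, 4⟩ : WeierstrassCurve ℤ).map (Int.castRingHom ℚ)).HasSurjectiveModNGaloisRep
      (5 ^ m : ℕ) := by
  have hn : ∀ t : ZMod 5, t ^ 2 - (((3 : ℕ) : ℤ) + 1 - (7 : ℕ) : ℤ) * t + ((3 : ℕ) : ZMod 5) ≠ 0 := by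
    decide +kernel
  haveI := Fact.mk (by norm_num : Nat.Prime 5)
  haveI := Fact.mk (by norm_num : Nat.Prime 3)
  haveI := isElliptic_c446d1
  haveI := isGloballyMinimal_c446d1
  exact hasSurjectiveModNGaloisRep_pow_of_intModel_certificate intModel
    (by rw [Int.isCoprime_iff_gcd_eq_one]; decide +kernel) 5 3 (by norm_num) (by decide +kernel)
    (n := 7) card_3 hn 223 (by norm_num) (by norm_num) (by decide +kernel) (by decide +kernel)
    (e := 1) (by decide +kernel) (by decide +kernel) (by decide +kernel) m

/-- **`446d1` is not CM** (multiplicative reduction at `223`; a CM curve has integral `j`).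
[cite: SilvermanATAEC1994, Thm. II.6.4 (PDF p. 148)] [cite: CremonaAlgorithms1997, Table 1 (446d1)] -/
theorem not_hasCM :
    haveI := isElliptic_c446d1;
    ¬ ((⟨1, -1, 0, -4, 4⟩ : WeierstrassCurve ℤ).map (Int.castRingHom ℚ)).HasCM := by
  haveI := isElliptic_c446d1
  haveI := isGloballyMinimal_c446d1
  haveI := Fact.mk (by norm_num : Nat.Prime 223)
  intro hCM
  exact not_hasMultiplicativeReductionAtPrime_of_hasCM _ hCM 223
    (IntModel.hasMultiplicativeReductionAtPrime_of_intModel intModel 223 (by decide +kernel)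
      (by decide +kernel))

/-- **DEPTH-TABLE ROW `446d1`, `(p, d_K, ℓ) = (5, -23, 19)`, WITHOUT Kolyvagin's structure theorem**:
for ANY imaginary quadratic `K` with `d_K = -23`, any frame `(Dt, β, ι)` and any COMPATIBLE system `d n`
of Kolyvagin–Heegner data, granted the five named McCallum/Gross leaves (Gross Prop. 5.4 (2);
McCallum Lemma 4.3, Prop. 4.4, Lemma 5.3, Prop. 2.2): the bit `(d 19).kolyvaginClass _ 1 ≠ 0` and one
rational point of infinite order on `E^{(-23)}` give `corank_{ℤ_5} Ш(E)[5^∞] = 0`,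
`rank_ℤ E(ℚ) = 2`, `rank_ℤ E^{(-23)}(ℚ) = 1`, `corank_{ℤ_5} Ш(E^{(-23)})[5^∞] = 0`; every
side condition (`5 ∈ B(E)`, non-CM, Heegner hypothesis, Kolyvagin prime, `2 ≤ rank`) is a kernel
theorem. Twin of `C446d1.depthRow_5_neg23_19` (file `…DepthTableRows1`, modulo `hF`).
CONDITIONAL on the five facts, the bit, the twist point; per-curve; BSD is not proved by it.
[cite: Kolyvagin1991MathAnn, Thm. 2.3] [cite: McCallumLMS1991, §§2–5]
[cite: JetchevLauterStein2009, §3.6 (arXiv:0707.0032)] -/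
theorem depthRow_5_neg23_19_of_print
    (h54 : sign_conjAct_kolyvaginClass) (h43 : lemma43_kolyvaginClass_mem_selmerLocalKer)
    (h44 : prop44_localOrder_kolyvaginClass_mul_eq) (h53 : lemma53_selmer_eigen_dependent_at)
    (h22 : prop22_reciprocity_eigen_finset)
    (K : Type) [Field K] [NumberField K] (hK : IsImaginaryQuadratic K)
    (hD : NumberField.discr K = -23) :
    haveI := isElliptic_c446d1;
    haveI := isGloballyMinimal_c446d1;
    haveI : NeZero (((⟨1, -1, 0, -4, 4⟩ : WeierstrassCurve ℤ).map (Int.castRingHom ℚ)).conductorNorm ℤ) :=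
      neZero_conductorNorm_of_isElliptic _;
    ∀ (Dt : ModularParametrizationData ((⟨1, -1, 0, -4, 4⟩ : WeierstrassCurve ℤ).map (Int.castRingHom ℚ))
        (((⟨1, -1, 0, -4, 4⟩ : WeierstrassCurve ℤ).map (Int.castRingHom ℚ)).conductorNorm ℤ)) (β : ℤ)
      (ι : K →+* ℂ) (d : ∀ m : ℕ, KolyvaginHeegnerData Dt β ι m),
    (∀ (m l : ℕ), ∀ l' ∈ m.primeFactors, ∀ (x : ringClassField K ι m)
      (x' : ringClassField K ι (m * l)),
      (x : ℂ) = x' → (((d (m * l)).σ l' x' : ringClassField K ι (m * l)) : ℂ) = ((d m).σ l' x : ℂ)) →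
    (∀ (m l : ℕ), ∀ s ∈ (d m).S, ∃ s' ∈ (d (m * l)).S, ∀ (x : ringClassField K ι m)
      (x' : ringClassField K ι (m * l)),
      (x : ℂ) = x' → ((s' x' : ringClassField K ι (m * l)) : ℂ) = (s x : ℂ)) →
    (∀ (m l : ℕ), ∀ s' ∈ (d (m * l)).S, ∃ s ∈ (d m).S, ∀ (x : ringClassField K ι m)
      (x' : ringClassField K ι (m * l)),
      (x : ℂ) = x' → ((s' x' : ringClassField K ι (m * l)) : ℂ) = (s x : ℂ)) →
    (∀ (m l : ℕ) (x : ringClassField K ι m) (x' : ringClassField K ι (m * l)),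
      (x : ℂ) = x' → (d (m * l)).emb x' = (d m).emb x) →
    (d 19).kolyvaginClass (p := 5) (by norm_num) 1 ≠ 0 →
    1 ≤ (((⟨1, -1, 0, -4, 4⟩ : WeierstrassCurve ℤ).map (Int.castRingHom ℚ)).quadraticTwist
      ((-23 : ℤ) : ℚ)).mordellWeilRank →
    ((⟨1, -1, 0, -4, 4⟩ : WeierstrassCurve ℤ).map (Int.castRingHom ℚ)).shaCorank 5 = 0 ∧
      ((⟨1, -1, 0, -4, 4⟩ : WeierstrassCurve ℤ).map (Int.castRingHom ℚ)).mordellWeilRank = 2 ∧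
      (((⟨1, -1, 0, -4, 4⟩ : WeierstrassCurve ℤ).map (Int.castRingHom ℚ)).quadraticTwist
        ((-23 : ℤ) : ℚ)).mordellWeilRank = 1 ∧
      (((⟨1, -1, 0, -4, 4⟩ : WeierstrassCurve ℤ).map (Int.castRingHom ℚ)).quadraticTwist
        ((-23 : ℤ) : ℚ)).shaCorank 5 = 0 := by
  haveI := isElliptic_c446d1
  haveI := isGloballyMinimal_c446d1
  haveI : NeZero (((⟨1, -1, 0, -4, 4⟩ : WeierstrassCurve ℤ).map (Int.castRingHom ℚ)).conductorNorm ℤ) :=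
    neZero_conductorNorm_of_isElliptic _
  intro Dt β ι d hσ hS₁ hS₂ hemb hne htw
  haveI := Fact.mk (by norm_num : Nat.Prime 5)
  exact depthRow_of_print_of_intModel_certificate intModel h54 h43 h44 h53 h22 not_hasCM
    KernelCerts001.C446d1.two_le_rank 5 (by norm_num) hasSurjectiveModNGaloisRep_pow_5 K hK hD
    (by norm_num) (by norm_num) heegner_neg23 19 (by norm_num) (by norm_num) (by decide +kernel)
    (by norm_num) (by norm_num) (by norm_num) (by norm_num) (n := 20) card_19 (by norm_num) Dt β ι
    d hσ hS₁ hS₂ hemb hne htw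

end C446d1

/-! ## Row `563a1` = `[1,1,1,-15,16]` (`N = 563, |Δ| = 563`): `(p, d_K, ℓ) = (5, -8, 199)` -/

namespace C563a1

/-- **`5 ∈ B(563a1)`: `ρ̄_{E,5^m}` onto for every `m`** (semistable `gcd(c₄, Δ) = 1`;
`X² − a_7 X + 7`, `a_7 = -5`, root-free mod `5`: `E[5]` irreducible (Mazur 6.3), onto (Serre
Prop. 21); the multiplicative prime `563 ∥ Δ` with `5 ∤ 1` lifts the image to `GL₂(ℤ/5^m)`).
[cite: Serre1972, §5.4 Prop. 21] [cite: SerreAbelianLadic1968, Ch. IV §3.4] -/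
theorem hasSurjectiveModNGaloisRep_pow_5 (m : ℕ) :
    ((⟨1, 1, 1, -15, 16⟩ : WeierstrassCurve ℤ).map (Int.castRingHom ℚ)).HasSurjectiveModNGaloisRep
      (5 ^ m : ℕ) := by
  have hn : ∀ t : ZMod 5, t ^ 2 - (((7 : ℕ) : ℤ) + 1 - (13 : ℕ) : ℤ) * t + ((7 : ℕ) : ZMod 5) ≠ 0 := by
    decide +kernel
  haveI := Fact.mk (by norm_num : Nat.Prime 5)
  haveI := Fact.mk (by norm_num : Nat.Prime 7)
  haveI := isElliptic_c563a1
  haveI := isGloballyMinimal_c563a1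
  exact hasSurjectiveModNGaloisRep_pow_of_intModel_certificate intModel
    (by rw [Int.isCoprime_iff_gcd_eq_one]; decide +kernel) 5 7 (by norm_num) (by decide +kernel)
    (n := 13) card_7 hn 563 (by norm_num) (by norm_num) (by decide +kernel) (by decide +kernel)
    (e := 1) (by decide +kernel) (by decide +kernel) (by decide +kernel) m

/-- **`563a1` is not CM** (multiplicative reduction at `563`; a CM curve has integral `j`).
[cite: SilvermanATAEC1994, Thm. II.6.4 (PDF p. 148)] [cite: CremonaAlgorithms1997, Table 1 (563a1)] -/
theorem not_hasCM :
    haveI := isElliptic_c563a1;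
    ¬ ((⟨1, 1, 1, -15, 16⟩ : WeierstrassCurve ℤ).map (Int.castRingHom ℚ)).HasCM := by
  haveI := isElliptic_c563a1
  haveI := isGloballyMinimal_c563a1
  haveI := Fact.mk (by norm_num : Nat.Prime 563)
  intro hCM
  exact not_hasMultiplicativeReductionAtPrime_of_hasCM _ hCM 563
    (IntModel.hasMultiplicativeReductionAtPrime_of_intModel intModel 563 (by decide +kernel)
      (by decide +kernel))

/-- **DEPTH-TABLE ROW `563a1`, `(p, d_K, ℓ) = (5, -8, 199)`, WITHOUT Kolyvagin's structure theorem**: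
for ANY imaginary quadratic `K` with `d_K = -8`, any frame `(Dt, β, ι)` and any COMPATIBLE system `d n`
of Kolyvagin–Heegner data, granted the five named McCallum/Gross leaves (Gross Prop. 5.4 (2);
McCallum Lemma 4.3, Prop. 4.4, Lemma 5.3, Prop. 2.2): the bit `(d 199).kolyvaginClass _ 1 ≠ 0` and one
rational point of infinite order on `E^{(-8)}` give `corank_{ℤ_5} Ш(E)[5^∞] = 0`,
`rank_ℤ E(ℚ) = 2`, `rank_ℤ E^{(-8)}(ℚ) = 1`, `corank_{ℤ_5} Ш(E^{(-8)})[5^∞] = 0`; every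
side condition (`5 ∈ B(E)`, non-CM, Heegner hypothesis, Kolyvagin prime, `2 ≤ rank`) is a kernel
theorem. Twin of `C563a1.depthRow_5_neg8_199` (file `…DepthTableRows2`, modulo `hF`).
CONDITIONAL on the five facts, the bit, the twist point; per-curve; BSD is not proved by it.
[cite: Kolyvagin1991MathAnn, Thm. 2.3] [cite: McCallumLMS1991, §§2–5]
[cite: JetchevLauterStein2009, §3.6 (arXiv:0707.0032)] -/
theorem depthRow_5_neg8_199_of_print
    (h54 : sign_conjAct_kolyvaginClass) (h43 : lemma43_kolyvaginClass_mem_selmerLocalKer)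
    (h44 : prop44_localOrder_kolyvaginClass_mul_eq) (h53 : lemma53_selmer_eigen_dependent_at)
    (h22 : prop22_reciprocity_eigen_finset)
    (K : Type) [Field K] [NumberField K] (hK : IsImaginaryQuadratic K)
    (hD : NumberField.discr K = -8) :
    haveI := isElliptic_c563a1;
    haveI := isGloballyMinimal_c563a1;
    haveI : NeZero (((⟨1, 1, 1, -15, 16⟩ : WeierstrassCurve ℤ).map (Int.castRingHom ℚ)).conductorNorm ℤ) :=
      neZero_conductorNorm_of_isElliptic _;
    ∀ (Dt : ModularParametrizationData ((⟨1, 1, 1, -15, 16⟩ : WeierstrassCurve ℤ).map (Int.castRingHom ℚ))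
        (((⟨1, 1, 1, -15, 16⟩ : WeierstrassCurve ℤ).map (Int.castRingHom ℚ)).conductorNorm ℤ)) (β : ℤ)
      (ι : K →+* ℂ) (d : ∀ m : ℕ, KolyvaginHeegnerData Dt β ι m),
    (∀ (m l : ℕ), ∀ l' ∈ m.primeFactors, ∀ (x : ringClassField K ι m)
      (x' : ringClassField K ι (m * l)),
      (x : ℂ) = x' → (((d (m * l)).σ l' x' : ringClassField K ι (m * l)) : ℂ) = ((d m).σ l' x : ℂ)) →
    (∀ (m l : ℕ), ∀ s ∈ (d m).S, ∃ s' ∈ (d (m * l)).S, ∀ (x : ringClassField K ι m)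
      (x' : ringClassField K ι (m * l)),
      (x : ℂ) = x' → ((s' x' : ringClassField K ι (m * l)) : ℂ) = (s x : ℂ)) →
    (∀ (m l : ℕ), ∀ s' ∈ (d (m * l)).S, ∃ s ∈ (d m).S, ∀ (x : ringClassField K ι m)
      (x' : ringClassField K ι (m * l)),
      (x : ℂ) = x' → ((s' x' : ringClassField K ι (m * l)) : ℂ) = (s x : ℂ)) →
    (∀ (m l : ℕ) (x : ringClassField K ι m) (x' : ringClassField K ι (m * l)),
      (x : ℂ) = x' → (d (m * l)).emb x' = (d m).emb x) →
    (d 199).kolyvaginClass (p := 5) (by norm_num) 1 ≠ 0 →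
    1 ≤ (((⟨1, 1, 1, -15, 16⟩ : WeierstrassCurve ℤ).map (Int.castRingHom ℚ)).quadraticTwist
      ((-8 : ℤ) : ℚ)).mordellWeilRank →
    ((⟨1, 1, 1, -15, 16⟩ : WeierstrassCurve ℤ).map (Int.castRingHom ℚ)).shaCorank 5 = 0 ∧
      ((⟨1, 1, 1, -15, 16⟩ : WeierstrassCurve ℤ).map (Int.castRingHom ℚ)).mordellWeilRank = 2 ∧
      (((⟨1, 1, 1, -15, 16⟩ : WeierstrassCurve ℤ).map (Int.castRingHom ℚ)).quadraticTwist
        ((-8 : ℤ) : ℚ)).mordellWeilRank = 1 ∧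
      (((⟨1, 1, 1, -15, 16⟩ : WeierstrassCurve ℤ).map (Int.castRingHom ℚ)).quadraticTwist
        ((-8 : ℤ) : ℚ)).shaCorank 5 = 0 := by
  haveI := isElliptic_c563a1
  haveI := isGloballyMinimal_c563a1
  haveI : NeZero (((⟨1, 1, 1, -15, 16⟩ : WeierstrassCurve ℤ).map (Int.castRingHom ℚ)).conductorNorm ℤ) :=
    neZero_conductorNorm_of_isElliptic _
  intro Dt β ι d hσ hS₁ hS₂ hemb hne htw
  haveI := Fact.mk (by norm_num : Nat.Prime 5)
  exact depthRow_of_print_of_intModel_certificate intModel h54 h43 h44 h53 h22 not_hasCM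
    KernelCerts001.C563a1.two_le_rank 5 (by norm_num) hasSurjectiveModNGaloisRep_pow_5 K hK hD
    (by norm_num) (by norm_num) heegner_neg8 199 (by norm_num) (by norm_num) (by decide +kernel)
    (by norm_num) (by norm_num) (by norm_num) (by norm_num) (n := 220) card_199 (by norm_num) Dt β ι
    d hσ hS₁ hS₂ hemb hne htw

end C563a1

end Summit.BirchSwinnertonDyer.BirchSwinnertonDyer.Theorems.KolyvaginDepthDoor

end
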